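import Summits.Parity.GeneralizedHardyLittlewood.Theorems.BeyondDiagonalBeatsQuarter.PeterssonSplitAFE
import Literature.NumberTheory.LFunctions.KMVCentralValueSquaredAFESeries
import Literature.NumberTheory.LFunctions.KowalskiMichelPeterssonFormulaHolds
import HarnessLib

/-!
# Route `PrimeLevelFamEdge`, crux K_B (stmt-Parity-20343), line `diagonal_kernel_split`, helper H4
# (exact Petersson/AFE split), part (c): Petersson's formula inside the AFE series —
# `T_q(l,m) = DIAG_q(l,m) − OFF_q(l,m)`, both absolutely convergent double series

With part (b) (`twistedSecond_eq_tsum`): `T_q(l,m) = 2q̂ Σ_{n} w_q(n) Σ_{d₁,d₂} Δ_q(l n₁/d₁², m n₂/d₂²)` for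
`1 ≤ l, m < q` prime. Petersson's formula at prime level (`kowalskiMichel2000_peterssonFormula_holds`:
`Δ_q(u,v) = δ(u,v) − J_q(u,v)`, `J_q` the Kloosterman–Bessel series `KowalskiMichel2000.petJ`) splits every
term; the diagonal count `diagCount l m n = #{(d₁,d₂) : d₁ ∣ (l,n₁), d₂ ∣ (m,n₂), l n₁/d₁² = m n₂/d₂²}` is
`≤ τ(l)τ(m)` and the AFE weight is absolutely summable (`summable_afeWeight`, from `W(y) ≤ 48/y²`), so the
diagonal series converges absolutely and the off-diagonal one does as a difference:
**`twistedSecond_eq_diag_sub_off`**: `T_q(l,m) = 2q̂ Σ_n w_q(n)·diagCount − 2q̂ Σ_n w_q(n)·Σ_{d₁,d₂} J_q(…)`.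
Part (d) (to come) resums the diagonal series to `(lm)^{1/2}·Corner.trueDiagKernel q̂ l m`.
Helper; identities and absolute convergence only; closes nothing; standard axioms.
«The programme SEARCHES and TYPES; no claim about Landau–Siegel zeros, Theorems 1–2 of arXiv:2211.02515 or
a repaired Margin232 until a kernel theorem says so.»
-/

noncomputable section

open Finset Polynomial CongruenceSubgroup
open scoped Real

namespace Summit.Parity.GeneralizedHardyLittlewood.Theorems.BeyondDiagonalBeatsQuarter.PeterssonSplit

open Literature.NumberTheory.LFunctions Literature.NumberTheory.LFunctions.KMV2000
open Literature.NumberTheory.EllipticCurves.ModularForms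

variable {q : ℕ} [NeZero q]

/-! ### The AFE weight is non-negative and absolutely summable -/

omit [NeZero q] in
/-- `w_q(n) ≥ 0`. [cite: KowalskiMichelVanderKam2000, (21)–(22) p. 12] -/
theorem afeWeight_nonneg (q : ℕ) (n : ℕ × ℕ) : 0 ≤ afeWeight q n :=
  mul_nonneg (Real.rpow_nonneg (by positivity) _) (cutoffW_nonneg _)

omit [NeZero q] in
/-- `w_q(n₁,n₂) ≤ 48 q̂⁴ · n₁^{−5/2} n₂^{−5/2}` (`W(y) ≤ 48/y²`; the bound is `0 ≤ 0` on the axes).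
[cite: KowalskiMichelVanderKam2000, (22) p. 12] -/
theorem afeWeight_le (hq : 1 ≤ q) (n : ℕ × ℕ) :
    afeWeight q n ≤ 48 * qhat q ^ 4 * ((n.1 : ℝ) ^ (-(5 / 2 : ℝ)) * (n.2 : ℝ) ^ (-(5 / 2 : ℝ))) := by
  have hQ : 0 < qhat q := qhat_pos hq
  rcases Nat.eq_zero_or_pos n.1 with h1 | h1
  · simp [afeWeight, h1, Real.zero_rpow (by norm_num : (-(5 / 2 : ℝ)) ≠ 0)]
  rcases Nat.eq_zero_or_pos n.2 with h2 | h2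
  · simp [afeWeight, h2, Real.zero_rpow (by norm_num : (-(5 / 2 : ℝ)) ≠ 0)]
  have hx : (0 : ℝ) < (n.1 : ℝ) * n.2 := by positivity
  have hy : 0 < (n.1 : ℝ) * n.2 / qhat q ^ 2 := by positivity
  unfold afeWeight
  calc ((n.1 : ℝ) * n.2) ^ (-(1 / 2 : ℝ)) * cutoffW ((n.1 : ℝ) * n.2 / qhat q ^ 2)
      ≤ ((n.1 : ℝ) * n.2) ^ (-(1 / 2 : ℝ)) * (48 / ((n.1 : ℝ) * n.2 / qhat q ^ 2) ^ 2) :=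
        mul_le_mul_of_nonneg_left (cutoffW_le_div_sq hy) (by positivity)
    _ = 48 * qhat q ^ 4 * (((n.1 : ℝ) * n.2) ^ (-(1 / 2 : ℝ)) * (((n.1 : ℝ) * n.2) ^ 2)⁻¹) := by
        field_simp
    _ ≤ 48 * qhat q ^ 4 * ((n.1 : ℝ) ^ (-(5 / 2 : ℝ)) * (n.2 : ℝ) ^ (-(5 / 2 : ℝ))) := by
        refine mul_le_mul_of_nonneg_left (le_of_eq ?_) (by positivity)
        rw [← Real.rpow_natCast, ← Real.rpow_neg hx.le, ← Real.rpow_add hx,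
          Real.mul_rpow (by positivity) (by positivity)]
        norm_num

omit [NeZero q] in
/-- **The AFE weight is absolutely summable over `ℕ × ℕ`.** [cite: KowalskiMichelVanderKam2000, (22) p. 12] -/
theorem summable_afeWeight (hq : 1 ≤ q) : Summable (afeWeight q) := by
  have h52 : Summable (fun n : ℕ ↦ (n : ℝ) ^ (-(5 / 2 : ℝ))) :=
    Real.summable_nat_rpow.2 (by norm_num)
  have hprod : Summable (fun n : ℕ × ℕ ↦ (n.1 : ℝ) ^ (-(5 / 2 : ℝ)) * (n.2 : ℝ) ^ (-(5 / 2 : ℝ))) :=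
    Summable.mul_of_nonneg h52 h52 (fun _ ↦ by positivity) (fun _ ↦ by positivity)
  refine Summable.of_nonneg_of_le (afeWeight_nonneg q) (afeWeight_le hq) ?_
  exact hprod.mul_left _

/-! ### The diagonal count -/

/-- The diagonal count `#{(d₁,d₂) : d₁ ∣ (l,n₁), d₂ ∣ (m,n₂), l n₁/d₁² = m n₂/d₂²}` of the Petersson
`δ`-terms inside the AFE ⊗ Hecke expansion. A bookkeeping abbreviation.
[cite: KowalskiMichelVanderKam2000, (21)–(23) p. 12 — derivation] -/
def diagCount (l m : ℕ) (n : ℕ × ℕ) : ℕ :=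
  (((l.gcd n.1).divisors ×ˢ (m.gcd n.2).divisors).filter
    (fun d : ℕ × ℕ ↦ l * n.1 / d.1 ^ 2 = m * n.2 / d.2 ^ 2)).card

omit [NeZero q] in
/-- `diagCount l m n ≤ τ(l)·τ(m)`. [folklore] -/
theorem diagCount_le {l m : ℕ} (hl : l ≠ 0) (hm : m ≠ 0) (n : ℕ × ℕ) :
    diagCount l m n ≤ l.divisors.card * m.divisors.card := by
  unfold diagCount
  refine (Finset.card_filter_le _ _).trans ?_
  rw [Finset.card_product]
  exact Nat.mul_le_mul (Finset.card_le_card (Nat.divisors_subset_of_dvd hl (Nat.gcd_dvd_left _ _)))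
    (Finset.card_le_card (Nat.divisors_subset_of_dvd hm (Nat.gcd_dvd_left _ _)))

/-! ### Petersson inside the series: `T = DIAG − OFF` -/

/-- Termwise Petersson: for `n₁, n₂ ≥ 1` and `1 ≤ l, m`,
`Σ_{d₁,d₂} Δ_q(l n₁/d₁², m n₂/d₂²) = diagCount − Σ_{d₁,d₂} J_q(l n₁/d₁², m n₂/d₂²)`.
[cite: KowalskiMichel2000, §2.4.2 p. 312 (Petersson's formula)] -/
theorem sum_pet_eq (hq : q.Prime) {l m : ℕ} (hl : 1 ≤ l) (hm : 1 ≤ m) {n : ℕ × ℕ} (h1 : 1 ≤ n.1)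
    (h2 : 1 ≤ n.2) :
    ∑ d₁ ∈ (l.gcd n.1).divisors, ∑ d₂ ∈ (m.gcd n.2).divisors,
        KowalskiMichel2000.pet q (l * n.1 / d₁ ^ 2) (m * n.2 / d₂ ^ 2) =
      (diagCount l m n : ℂ) -
        ∑ d₁ ∈ (l.gcd n.1).divisors, ∑ d₂ ∈ (m.gcd n.2).divisors,
          KowalskiMichel2000.petJ q (l * n.1 / d₁ ^ 2) (m * n.2 / d₂ ^ 2) := by
  classical
  have hP := KowalskiMichel2000.kowalskiMichel2000_peterssonFormula_holds
  -- each (d₁, d₂): u, v ≥ 1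
  have huv : ∀ d₁ ∈ (l.gcd n.1).divisors, ∀ d₂ ∈ (m.gcd n.2).divisors,
      1 ≤ l * n.1 / d₁ ^ 2 ∧ 1 ≤ m * n.2 / d₂ ^ 2 := by
    intro d₁ hd₁ d₂ hd₂
    have hd₁' := Nat.dvd_of_mem_divisors hd₁
    have hd₂' := Nat.dvd_of_mem_divisors hd₂
    have hd₁0 : 0 < d₁ := Nat.pos_of_mem_divisors hd₁
    have hd₂0 : 0 < d₂ := Nat.pos_of_mem_divisors hd₂
    constructor
    · have hdiv : d₁ ^ 2 ∣ l * n.1 := by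
        rw [sq]; exact Nat.mul_dvd_mul (hd₁'.trans (Nat.gcd_dvd_left _ _)) (hd₁'.trans (Nat.gcd_dvd_right _ _))
      exact Nat.one_le_iff_ne_zero.2 (fun h0 ↦ by
        have := Nat.eq_zero_of_dvd_of_div_eq_zero hdiv h0
        have : 0 < l * n.1 := Nat.mul_pos hl h1
        omega)
    · have hdiv : d₂ ^ 2 ∣ m * n.2 := by
        rw [sq]; exact Nat.mul_dvd_mul (hd₂'.trans (Nat.gcd_dvd_left _ _)) (hd₂'.trans (Nat.gcd_dvd_right _ _))
      exact Nat.one_le_iff_ne_zero.2 (fun h0 ↦ by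
        have := Nat.eq_zero_of_dvd_of_div_eq_zero hdiv h0
        have : 0 < m * n.2 := Nat.mul_pos hm h2
        omega)
  have hterm : ∀ d₁ ∈ (l.gcd n.1).divisors, ∀ d₂ ∈ (m.gcd n.2).divisors,
      KowalskiMichel2000.pet q (l * n.1 / d₁ ^ 2) (m * n.2 / d₂ ^ 2) =
        (if l * n.1 / d₁ ^ 2 = m * n.2 / d₂ ^ 2 then (1 : ℂ) else 0) -
          KowalskiMichel2000.petJ q (l * n.1 / d₁ ^ 2) (m * n.2 / d₂ ^ 2) := by
    intro d₁ hd₁ d₂ hd₂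
    obtain ⟨hu, hv⟩ := huv d₁ hd₁ d₂ hd₂
    exact (hP q hq _ _ hu hv).2
  rw [Finset.sum_congr rfl fun d₁ hd₁ ↦ Finset.sum_congr rfl fun d₂ hd₂ ↦ hterm d₁ hd₁ d₂ hd₂]
  simp only [Finset.sum_sub_distrib]
  congr 1
  -- the δ-count
  rw [diagCount, ← Finset.sum_product', Finset.card_filter]
  push_cast
  rfl

/-- **H4 (c): `T_q(l,m) = DIAG_q(l,m) − OFF_q(l,m)`** with both double series absolutely convergent:
`DIAG = 2q̂ Σ_n w_q(n)·diagCount l m n`, `OFF = 2q̂ Σ_n w_q(n)·Σ_{d₁,d₂} J_q(l n₁/d₁², m n₂/d₂²)`, for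
`q` prime, `1 ≤ l, m < q`. [cite: KowalskiMichelVanderKam2000, (21)–(23) p. 12; KowalskiMichel2000, §2.4.2 p. 312 — derivation] -/
theorem twistedSecond_eq_diag_sub_off (hq : q.Prime) {l m : ℕ} (hl : 1 ≤ l) (hlq : l < q)
    (hm : 1 ≤ m) (hmq : m < q) :
    Summable (fun n : ℕ × ℕ ↦ (afeWeight q n : ℂ) * (diagCount l m n : ℂ)) ∧
    Summable (fun n : ℕ × ℕ ↦ (afeWeight q n : ℂ) *
      ∑ d₁ ∈ (l.gcd n.1).divisors, ∑ d₂ ∈ (m.gcd n.2).divisors,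
        KowalskiMichel2000.petJ q (l * n.1 / d₁ ^ 2) (m * n.2 / d₂ ^ 2)) ∧
    twistedSecond q l m =
      2 * (qhat q : ℂ) * ∑' n : ℕ × ℕ, (afeWeight q n : ℂ) * (diagCount l m n : ℂ) -
        2 * (qhat q : ℂ) * ∑' n : ℕ × ℕ, (afeWeight q n : ℂ) *
          ∑ d₁ ∈ (l.gcd n.1).divisors, ∑ d₂ ∈ (m.gcd n.2).divisors,
            KowalskiMichel2000.petJ q (l * n.1 / d₁ ^ 2) (m * n.2 / d₂ ^ 2) := by
  obtain ⟨hS, hT⟩ := twistedSecond_eq_tsum hq hl hlq hm hmq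
  have hq1 : 1 ≤ q := hq.one_lt.le
  -- the diagonal series is dominated by τ(l)τ(m)·w
  have hD : Summable (fun n : ℕ × ℕ ↦ (afeWeight q n : ℂ) * (diagCount l m n : ℂ)) := by
    refine Summable.of_norm_bounded (g := fun n ↦ afeWeight q n * (l.divisors.card * m.divisors.card : ℕ))
      (((summable_afeWeight hq1).mul_right _)) fun n ↦ ?_
    rw [norm_mul, Complex.norm_real, Real.norm_of_nonneg (afeWeight_nonneg q n), Complex.norm_natCast]
    exact mul_le_mul_of_nonneg_left (by exact_mod_cast diagCount_le (by omega) (by omega) n)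
      (afeWeight_nonneg q n)
  -- termwise identity: w·Σpet = w·count − w·ΣJ (trivial on the axes, where w = 0)
  have hpt : ∀ n : ℕ × ℕ, (afeWeight q n : ℂ) *
      ∑ d₁ ∈ (l.gcd n.1).divisors, ∑ d₂ ∈ (m.gcd n.2).divisors,
        KowalskiMichel2000.pet q (l * n.1 / d₁ ^ 2) (m * n.2 / d₂ ^ 2) =
      (afeWeight q n : ℂ) * (diagCount l m n : ℂ) - (afeWeight q n : ℂ) *
        ∑ d₁ ∈ (l.gcd n.1).divisors, ∑ d₂ ∈ (m.gcd n.2).divisors,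
          KowalskiMichel2000.petJ q (l * n.1 / d₁ ^ 2) (m * n.2 / d₂ ^ 2) := by
    intro n
    rcases Nat.eq_zero_or_pos n.1 with h1 | h1
    · have : afeWeight q n = 0 := by simp [afeWeight, h1]
      simp [this]
    rcases Nat.eq_zero_or_pos n.2 with h2 | h2
    · have : afeWeight q n = 0 := by simp [afeWeight, h2]
      simp [this]
    rw [sum_pet_eq hq hl hm h1 h2, mul_sub]
  have hfun : (fun n : ℕ × ℕ ↦ (afeWeight q n : ℂ) *
      ∑ d₁ ∈ (l.gcd n.1).divisors, ∑ d₂ ∈ (m.gcd n.2).divisors,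
        KowalskiMichel2000.pet q (l * n.1 / d₁ ^ 2) (m * n.2 / d₂ ^ 2)) =
      fun n ↦ (afeWeight q n : ℂ) * (diagCount l m n : ℂ) - (afeWeight q n : ℂ) *
        ∑ d₁ ∈ (l.gcd n.1).divisors, ∑ d₂ ∈ (m.gcd n.2).divisors,
          KowalskiMichel2000.petJ q (l * n.1 / d₁ ^ 2) (m * n.2 / d₂ ^ 2) := funext hpt
  -- OFF = DIAG − (w·Σpet) is summable
  have hO : Summable (fun n : ℕ × ℕ ↦ (afeWeight q n : ℂ) *
      ∑ d₁ ∈ (l.gcd n.1).divisors, ∑ d₂ ∈ (m.gcd n.2).divisors,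
        KowalskiMichel2000.petJ q (l * n.1 / d₁ ^ 2) (m * n.2 / d₂ ^ 2)) := by
    have := hD.sub (hfun ▸ hS)
    refine this.congr fun n ↦ ?_
    simp only [sub_sub_cancel]
  refine ⟨hD, hO, ?_⟩
  rw [hT, hfun, hD.tsum_sub hO, mul_sub]

end Summit.Parity.GeneralizedHardyLittlewood.Theorems.BeyondDiagonalBeatsQuarter.PeterssonSplit
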